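import Literature.MathematicalPhysics.QuantumLattice.HubbardGaugeBound
import Literature.MathematicalPhysics.QuantumLattice.MagneticHubbardTorus
import HarnessLib

/-!
# The lattice Bogoliubov–de Gennes Hamiltonian with arbitrary bond data and its gauge covariance

Topic `Literature/MathematicalPhysics/QuantumLattice` (definition request `defn-bdgBondHamiltonian`,
route `HubbardSuperconductivity/NodalWardXY`, items `stmt-HubbardSuperconductivity-1266`
(`VisonPairCost`) and `-1270` (`GaugeCovariance`); also the vortex / flux-insertion idea cards).
Everything is built on the tree's concrete Fock-space model (`HubbardWave0`: `Fock ι = ℓ²(Finset ι)`,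
Jordan–Wigner matrices `creation`, `annihilation`, Hubbard orbitals `Orb Λ = Λ ×ₗ Fin 2`,
`orb x σ`, `numberOp`, `totalNumber`; `HubbardModel.hamiltonianWith`; `HubbardGaugeBound.hoppingForm`).

## Contents (all statements PROVED; no named facts)

* `bdgHopping τ = Σ_{x,y,σ} τ(x,y) c†_{xσ} c_{yσ}`, `bdgPairing Δ = Σ_{x,y} Δ(x,y) (c_{x↑}c_{y↓} - c_{x↓}c_{y↑})`
  and the **lattice BdG Hamiltonian with bond data**
  `bdgBondHamiltonian τ Δ μ = bdgHopping τ + (bdgPairing Δ + (bdgPairing Δ)ᴴ) - μ N`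
  for ARBITRARY complex hopping amplitudes `τ : Λ → Λ → ℂ` and singlet pairing amplitudes
  `Δ : Λ → Λ → ℂ` on a finite linearly ordered site set `Λ` (vortices, fluxes, `ℤ₂` strings and
  twists are all encoded in the bond data).
* API: linearity in `(τ, Δ)`; `bdgHopping_conjTranspose`, `isHermitian_bdgBondHamiltonian`
  (Hermitian when `τ(y,x) = conj τ(x,y)`); `bdgHopping_adj` (graph-supported real weights give
  `hoppingForm`) and `bdgBondHamiltonian_adj_zero`
  (`bdgBondHamiltonian (-t·[x ∼ y]) 0 μ = hamiltonianWith G t 0 μ`, the `U = 0` Hubbard model).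
* Conjugation by the tree's unitary site-phase transformation `phaseGauge g`
  (`MagneticHubbardTorus.lean`; `g : Λ → U(1)`, `W_g|s⟩ = (∏_{(x,σ)∈s} g_x)|s⟩`):
  `W_g c_{xσ} W_gᴴ = conj(g_x) c_{xσ}`, `W_g c†_{xσ} W_gᴴ = g_x c†_{xσ}`, `W_g n W_gᴴ = n`,
  multiplicativity, and the real-angle form `phaseGauge (e^{iθ}) = diag(e^{iΣθ})`
  (`phaseGauge_exp_eq_diagonal`).
* **`U(1)` gauge covariance** `phaseGauge_mul_bdgBondHamiltonian_mul_conjTranspose`: conjugation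
  by `W_g` multiplies `τ(x,y)` by `g_x conj(g_y)` (a Peierls factor; `e^{i(θ_x-θ_y)}` at real
  angles, `phaseGauge_exp_mul_bdgBondHamiltonian_mul_conjTranspose`) and `Δ(x,y)` by
  `conj(g_x g_y)` (`e^{-i(θ_x+θ_y)}`); and its **`ℤ₂` special case**
  `phaseGauge_sign_mul_bdgBondHamiltonian_mul_conjTranspose` (`g = -1` on `S` flips the sign of
  the bond data on the bonds with exactly one end in `S`).

The torus specialisation with nearest-neighbour data per (site, direction), and its comparison
with `hubbardTorusWith` / `dWaveSourceTorus`, is the companion file `BdGBondHamiltonianTorus.lean`.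

## Sources

* P. G. de Gennes, *Superconductivity of Metals and Alloys* (Benjamin 1966), Ch. 5: the
  self-consistent-field (mean-field pairing) Hamiltonian, §5-1 eq. (5-12), the Bogoliubov
  equations (5-18), and the gauge covariance of the pair potential, §5-2 eqs. (5-33)–(5-38).
  [deGennes1966]
* O. Vafek, A. Melikyan, M. Franz, Z. Tešanović, PRB 63 (2001) 134509, §II eqs. (2)–(4) (the
  tight-binding lattice BdG Hamiltonian with Peierls phases on the hoppings and bond pairing
  `Δ̂ = Δ₀ Σ_δ e^{iφ/2} η̂_δ e^{iφ/2}`) and Appendix A eqs. (A1)–(A2) (the general bond pairing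
  term `Σ_{⟨ij⟩} Δ(i,j)[u*(i)v(j) + u*(j)v(i)] + h.c.` and its gauge law
  `Δ(i,j) ↦ Δ(i,j) e^{iχ(i)+iχ(j)}`). [VafekEtAl2001]
* T. Koma, H. Tasaki, PRL 68 (1992) 3248, eqs. (5), (7), (8) (the gauge transformation
  `G(θ) = exp[i Σ θ_x n_x]` and the transformation of `c`, `c†`, hopping and pair operators).
  [KomaTasakiPRL1992]

## Mathlib / tree search

Tree (`lean search`): no Bogoliubov–de Gennes / pairing quadratic Hamiltonian existed
(`Bogoliubov|BdG|pairingHamiltonian`: nothing fermionic); `gaugeMatrix`/`siteGauge`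
(`HubbardGaugeBound`) are the NON-unitary imaginary-angle gauge matrices of Koma–Tasaki's proof,
the unitary site-phase transformation is `phaseGauge` of `MagneticHubbardTorus` (REUSED here;
only its conjugation action on the fields is proved in this file); `hoppingForm G w` (real graph weights),
`dGamma h` (`FermionQuasiFree`, number-conserving quadratic Hamiltonians), `bondOp`/`hopSum`
(`HubbardBondAlgebra`, hopping monomials with complex couplings) and the singlet bond pair
`Literature.Barriers.HubbardSuperconductivity.bondPair` (a barrier file, deliberately not imported
here; the summand of `bdgPairing` is that operator verbatim) are the nearest objects. Mathlib:
`Matrix.diagonal`, `Matrix.unitaryGroup`, `Complex.exp_conj`, `Complex.exp_pi_mul_I`.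

## Design notes

* Conventions follow the request: `Δ(x,y)` multiplies the pair ANNIHILATION operator
  `c_{x↑}c_{y↓} - c_{x↓}c_{y↑}` (as in the tree's `pairField`/`dWaveSourceTorus` source term
  `-h(Δ_d + Δ_d†)`), and the Hamiltonian adds its adjoint; the gauge transformation acts as
  `X ↦ W_g X W_gᴴ` with `W_g = phaseGauge g = diag(∏ g)` (`= diag(e^{+iΣθ})` for `g = e^{iθ}`), so
  that `c ↦ conj(g) c`, `c† ↦ g c†`, `τ(x,y) ↦ g_x conj(g_y) τ(x,y)`, `Δ(x,y) ↦ conj(g_x g_y) Δ(x,y)`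
  (the companion `MagneticHubbardTorusGauge` of the gauge file uses the opposite orientation
  `W_gᴴ H W_g`).
* The hopping sum runs over ALL ordered pairs `(x, y)` (a graph enters through the support of
  `τ`), exactly as `dGamma`; Hermiticity needs `τ(y,x) = conj τ(x,y)` and is stated with that
  hypothesis (`isHermitian_bdgBondHamiltonian`), never assumed in the definition.
* Spin-independent hopping only (as requested); spin-dependent twists (route `NodalDiracTwist`)
  would use `dGamma` of a one-body matrix on `Orb Λ` instead.
-/

noncomputable section

namespace Literature.MathematicalPhysics.QuantumLattice

open Matrix Finset
open scoped ComplexOrder ComplexConjugate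

/-! ### Conjugation by the unitary site-phase transformation `phaseGauge g` -/

section PhaseGaugeConj

variable {Λ : Type*} [LinearOrder Λ] [Fintype Λ]

/-- Unit modulus: `z · conj z = 1` for `z ∈ U(1)`. [folklore] -/
private theorem circle_coe_mul_conj (z : Circle) : (z : ℂ) * conj (z : ℂ) = 1 := by
  rw [Complex.mul_conj, Circle.normSq_coe, Complex.ofReal_one]

/-- `W_gᴴ W_g = 1` (a private copy: the unitary-group API of `phaseGauge` belongs to its home
file). [folklore] -/
private theorem conjTranspose_phaseGauge_mul_self' (g : Λ → Circle) :
    (phaseGauge g)ᴴ * phaseGauge g = 1 := by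
  rw [phaseGauge, diagonal_conjTranspose, diagonal_mul_diagonal, ← diagonal_one]
  congr 1
  funext s
  rw [Pi.star_apply, Complex.star_def, mul_comm, circle_coe_mul_conj]

omit [Fintype Λ] in
/-- The real-angle form of the site-phase transformation: for `g = e^{iθ}`,
`phaseGauge g = diag(e^{i Σ_{(x,σ) ∈ s} θ_x}) = exp(i Σ_x θ_x (n_{x↑} + n_{x↓}))` — the shape in
which route statements (e.g. `NodalWardXY.GaugeCovariance`) write the gauge group.
Koma–Tasaki, PRL 68 (1992) 3248, eq. (5). [cite: KomaTasakiPRL1992, eq. (5)] -/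
theorem phaseGauge_exp_eq_diagonal (θ : Λ → ℝ) :
    phaseGauge (fun x => Circle.exp (θ x)) =
      diagonal fun s : Finset (Orb Λ) => Complex.exp (Complex.I * ∑ o ∈ s, (θ (ofLex o).1 : ℂ)) := by
  rw [phaseGauge]
  congr 1
  funext s
  rw [← Circle.coeHom_apply, map_prod, Finset.mul_sum, Complex.exp_sum]
  refine Finset.prod_congr rfl fun o _ => ?_
  rw [Circle.coeHom_apply, Circle.coe_exp, mul_comm]

/-- **`W_g c_{xσ} W_gᴴ = conj(g_x) c_{xσ}`** for the unitary site-phase transformation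
`W_g = phaseGauge g` (Koma–Tasaki's eq. (8) at real angles, `g = e^{iθ}`: `c_{xσ} ↦ e^{-iθ_x} c_{xσ}`;
the matrix element `⟨s| c |s ∪ {(x,σ)}⟩` picks up `(∏_s g)(conj g_x)(∏_s conj g)`).
[cite: KomaTasakiPRL1992, eqs. (7)–(8)] -/
theorem phaseGauge_mul_annihilation_mul_conjTranspose (g : Λ → Circle) (x : Λ) (σ : Fin 2) :
    phaseGauge g * annihilation (orb x σ) * (phaseGauge g)ᴴ =
      conj (g x : ℂ) • annihilation (orb x σ) := by
  ext s t
  simp only [phaseGauge, diagonal_conjTranspose, diagonal_mul, mul_diagonal, Pi.star_apply,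
    Matrix.smul_apply, smul_eq_mul, annihilation, Complex.star_def]
  split_ifs with h
  · rw [h.2, Finset.prod_insert h.1, show (ofLex (orb x σ)).1 = x from rfl, Circle.coe_mul, map_mul]
    linear_combination (conj (g x : ℂ) * jwSign (orb x σ) s) *
      circle_coe_mul_conj (∏ o ∈ s, g (ofLex o).1)
  · simp

/-- **`W_g c†_{xσ} W_gᴴ = g_x c†_{xσ}`**. [cite: KomaTasakiPRL1992, eqs. (7)–(8)] -/
theorem phaseGauge_mul_creation_mul_conjTranspose (g : Λ → Circle) (x : Λ) (σ : Fin 2) :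
    phaseGauge g * creation (orb x σ) * (phaseGauge g)ᴴ = (g x : ℂ) • creation (orb x σ) := by
  have h := congrArg conjTranspose (phaseGauge_mul_annihilation_mul_conjTranspose g x σ)
  rw [conjTranspose_mul, conjTranspose_mul, conjTranspose_conjTranspose, annihilation_conjTranspose,
    conjTranspose_smul, annihilation_conjTranspose, ← mul_assoc] at h
  rw [h, Complex.star_def, Complex.conj_conj]

/-- Conjugation by `W_g` is multiplicative (`W_gᴴ W_g = 1`). [folklore] -/
theorem phaseGauge_mul_mul_mul_conjTranspose (g : Λ → Circle)
    (X Y : Matrix (Finset (Orb Λ)) (Finset (Orb Λ)) ℂ) :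
    phaseGauge g * (X * Y) * (phaseGauge g)ᴴ =
      phaseGauge g * X * (phaseGauge g)ᴴ * (phaseGauge g * Y * (phaseGauge g)ᴴ) := by
  calc phaseGauge g * (X * Y) * (phaseGauge g)ᴴ
      = phaseGauge g * X * ((phaseGauge g)ᴴ * phaseGauge g) * Y * (phaseGauge g)ᴴ := by
        rw [conjTranspose_phaseGauge_mul_self']; noncomm_ring
    _ = phaseGauge g * X * (phaseGauge g)ᴴ * (phaseGauge g * Y * (phaseGauge g)ᴴ) := by
        noncomm_ring

/-- Conjugation by `W_g` commutes with taking adjoints. [folklore] -/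
theorem phaseGauge_mul_conjTranspose_mul_conjTranspose (g : Λ → Circle)
    (X : Matrix (Finset (Orb Λ)) (Finset (Orb Λ)) ℂ) :
    phaseGauge g * Xᴴ * (phaseGauge g)ᴴ = (phaseGauge g * X * (phaseGauge g)ᴴ)ᴴ := by
  rw [conjTranspose_mul, conjTranspose_mul, conjTranspose_conjTranspose, mul_assoc]

/-- The number operators are gauge invariant: `W_g n_{xσ} W_gᴴ = n_{xσ}`.
[cite: KomaTasakiPRL1992, eq. (7)] -/
theorem phaseGauge_mul_numberOp_mul_conjTranspose (g : Λ → Circle) (x : Λ) (σ : Fin 2) :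
    phaseGauge g * numberOp x σ * (phaseGauge g)ᴴ = numberOp x σ := by
  rw [numberOp, phaseGauge_mul_mul_mul_conjTranspose, phaseGauge_mul_creation_mul_conjTranspose,
    phaseGauge_mul_annihilation_mul_conjTranspose, smul_mul_smul, circle_coe_mul_conj, one_smul]

/-- The total particle number is gauge invariant: `W_g N W_gᴴ = N`. [cite: KomaTasakiPRL1992, eq. (7)] -/
theorem phaseGauge_mul_totalNumber_mul_conjTranspose (g : Λ → Circle) :
    phaseGauge g * totalNumber * (phaseGauge g)ᴴ = totalNumber := by
  unfold totalNumber
  simp only [Finset.mul_sum, Finset.sum_mul, phaseGauge_mul_numberOp_mul_conjTranspose]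

end PhaseGaugeConj

/-! ### The BdG Hamiltonian with bond data -/

section BdG

variable {Λ : Type*} [LinearOrder Λ] [Fintype Λ]

/-- The hopping (particle-number conserving) part of a lattice BdG Hamiltonian with arbitrary
complex bond amplitudes: `T(τ) = Σ_{x,y} Σ_σ τ(x,y) c†_{xσ} c_{yσ}` (all ordered pairs of sites,
both spins alike; a lattice graph and Peierls phases enter through `τ`). Vafek–Melikyan–Franz–
Tešanović, PRB 63 (2001) 134509, §II eqs. (2)–(3) (`ĥ = -t Σ_δ e^{-i∫A·dl} ŝ_δ - ε_F`).
[cite: VafekEtAl2001, §II eqs. (2)–(3)] -/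
def bdgHopping (τ : Λ → Λ → ℂ) : Matrix (Finset (Orb Λ)) (Finset (Orb Λ)) ℂ :=
  ∑ x : Λ, ∑ y : Λ, ∑ σ : Fin 2, τ x y • (creation (orb x σ) * annihilation (orb y σ))

/-- The singlet pairing part with arbitrary complex bond pairing amplitudes:
`P(Δ) = Σ_{x,y} Δ(x,y) (c_{x↑} c_{y↓} - c_{x↓} c_{y↑})` — pair ANNIHILATION operators, the BdG
Hamiltonian containing `P(Δ) + P(Δ)†`; the summand is the singlet bond pair of Scalapino's pair
field (the tree's `localPair g L x` is `Σ_e (g e/√2) ·` it). Vafek et al., PRB 63 (2001) 134509,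
Appendix A eq. (A1) (`Σ_{⟨ij⟩} Δ(i,j)[u*(i)v(j) + u*(j)v(i)] + h.c.`); de Gennes (1966) §5-1
eq. (5-12) (the pair potential `Δ` of the effective Hamiltonian). [cite: VafekEtAl2001, App. A eq. (A1)] -/
def bdgPairing (Δ : Λ → Λ → ℂ) : Matrix (Finset (Orb Λ)) (Finset (Orb Λ)) ℂ :=
  ∑ x : Λ, ∑ y : Λ, Δ x y •
    (annihilation (orb x 0) * annihilation (orb y 1) - annihilation (orb x 1) * annihilation (orb y 0))

/-- **The lattice Bogoliubov–de Gennes (BdG) Hamiltonian with bond data** `(τ, Δ)` and chemical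
potential `μ`, as an operator on the fermionic Fock space of `Orb Λ`:
`H_BdG(τ, Δ, μ) = Σ_{x,y,σ} τ(x,y) c†_{xσ} c_{yσ} + Σ_{x,y} (Δ(x,y)(c_{x↑}c_{y↓} - c_{x↓}c_{y↑}) + h.c.) - μ N`
— the second-quantised mean-field (BCS / Hartree–Fock–Bogoliubov) Hamiltonian of de Gennes'
self-consistent field method (de Gennes 1966, §5-1 eq. (5-12); its one-body eigenvalue problem
is the Bogoliubov–de Gennes equations (5-18)), in the tight-binding lattice form with arbitrary
complex bond hoppings and bond pairings of Vafek et al. (PRB 63 (2001) 134509, §II eqs. (2)–(4),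
App. A (A1)). Hermitian when `τ(y,x) = conj τ(x,y)` (`isHermitian_bdgBondHamiltonian`); vortices,
magnetic / `ℤ₂` fluxes and boundary twists are particular bond data.
[cite: deGennes1966, §5-1 eqs. (5-12) and (5-18)] -/
def bdgBondHamiltonian (τ Δ : Λ → Λ → ℂ) (μ : ℝ) : Matrix (Finset (Orb Λ)) (Finset (Orb Λ)) ℂ :=
  bdgHopping τ + (bdgPairing Δ + (bdgPairing Δ)ᴴ) - (μ : ℂ) • totalNumber

/-- `bdgBondHamiltonian` unfolded. [folklore] -/
theorem bdgBondHamiltonian_eq (τ Δ : Λ → Λ → ℂ) (μ : ℝ) :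
    bdgBondHamiltonian τ Δ μ =
      bdgHopping τ + (bdgPairing Δ + (bdgPairing Δ)ᴴ) - (μ : ℂ) • totalNumber := rfl

/-- `bdgHopping` unfolded. [folklore] -/
theorem bdgHopping_eq (τ : Λ → Λ → ℂ) :
    bdgHopping τ = ∑ x : Λ, ∑ y : Λ, ∑ σ : Fin 2,
      τ x y • (creation (orb x σ) * annihilation (orb y σ)) := rfl

/-- `bdgPairing` unfolded. [folklore] -/
theorem bdgPairing_eq (Δ : Λ → Λ → ℂ) :
    bdgPairing Δ = ∑ x : Λ, ∑ y : Λ, Δ x y •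
      (annihilation (orb x 0) * annihilation (orb y 1) -
        annihilation (orb x 1) * annihilation (orb y 0)) := rfl

/-- No hopping: `T(0) = 0`. [folklore] -/
@[simp] theorem bdgHopping_zero : bdgHopping (0 : Λ → Λ → ℂ) = 0 := by
  simp [bdgHopping]

/-- No pairing: `P(0) = 0`. [folklore] -/
@[simp] theorem bdgPairing_zero : bdgPairing (0 : Λ → Λ → ℂ) = 0 := by
  simp [bdgPairing]

/-- `T` is additive in the bond amplitudes. [folklore] -/
theorem bdgHopping_add (τ τ' : Λ → Λ → ℂ) : bdgHopping (τ + τ') = bdgHopping τ + bdgHopping τ' := by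
  simp only [bdgHopping, Pi.add_apply, add_smul, Finset.sum_add_distrib]

/-- `T` is homogeneous in the bond amplitudes. [folklore] -/
theorem bdgHopping_smul (a : ℂ) (τ : Λ → Λ → ℂ) : bdgHopping (a • τ) = a • bdgHopping τ := by
  simp only [bdgHopping, Pi.smul_apply, smul_eq_mul, Finset.smul_sum, smul_smul]

/-- `P` is additive in the pairing amplitudes. [folklore] -/
theorem bdgPairing_add (Δ Δ' : Λ → Λ → ℂ) : bdgPairing (Δ + Δ') = bdgPairing Δ + bdgPairing Δ' := by
  simp only [bdgPairing, Pi.add_apply, add_smul, Finset.sum_add_distrib]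

/-- `P` is homogeneous in the pairing amplitudes. [folklore] -/
theorem bdgPairing_smul (a : ℂ) (Δ : Λ → Λ → ℂ) : bdgPairing (a • Δ) = a • bdgPairing Δ := by
  simp only [bdgPairing, Pi.smul_apply, smul_eq_mul, Finset.smul_sum, smul_smul]

/-- Without bond data the BdG Hamiltonian is `-μ N`. [folklore] -/
theorem bdgBondHamiltonian_zero_zero (μ : ℝ) :
    bdgBondHamiltonian (0 : Λ → Λ → ℂ) 0 μ = -((μ : ℂ) • totalNumber) := by
  simp [bdgBondHamiltonian]

/-- The adjoint of the hopping part is the hopping part of the adjoint amplitudes,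
`T(τ)ᴴ = T(τ*)`, `τ*(x,y) = conj τ(y,x)` (`(c†_{xσ} c_{yσ})ᴴ = c†_{yσ} c_{xσ}`). [folklore] -/
theorem bdgHopping_conjTranspose (τ : Λ → Λ → ℂ) :
    (bdgHopping τ)ᴴ = bdgHopping fun x y => star (τ y x) := by
  simp only [bdgHopping, conjTranspose_sum, conjTranspose_smul, conjTranspose_mul,
    creation_conjTranspose, annihilation_conjTranspose]
  rw [Finset.sum_comm]

/-- The hopping part is Hermitian for Hermitian bond amplitudes `conj τ(x,y) = τ(y,x)`.
Vafek et al. (2001) §II. [folklore] -/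
theorem isHermitian_bdgHopping {τ : Λ → Λ → ℂ} (hτ : ∀ x y, star (τ x y) = τ y x) :
    (bdgHopping τ).IsHermitian := by
  rw [IsHermitian, bdgHopping_conjTranspose]
  congr 1
  funext x y
  exact hτ y x

/-- The pairing part of the Hamiltonian, `P(Δ) + P(Δ)†`, is Hermitian for every `Δ`. [folklore] -/
theorem isHermitian_bdgPairing_add_conjTranspose (Δ : Λ → Λ → ℂ) :
    (bdgPairing Δ + (bdgPairing Δ)ᴴ).IsHermitian :=
  isHermitian_add_transpose_self _

/-- **The BdG Hamiltonian is Hermitian** for Hermitian hopping amplitudes `conj τ(x,y) = τ(y,x)`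
(any pairing `Δ`, real `μ`). de Gennes (1966) §5-1; Vafek et al. (2001) §II. [folklore] -/
theorem isHermitian_bdgBondHamiltonian {τ : Λ → Λ → ℂ} (hτ : ∀ x y, star (τ x y) = τ y x)
    (Δ : Λ → Λ → ℂ) (μ : ℝ) : (bdgBondHamiltonian τ Δ μ).IsHermitian := by
  have hN : ((μ : ℂ) • (totalNumber : Matrix (Finset (Orb Λ)) (Finset (Orb Λ)) ℂ)).IsHermitian := by
    have hn : ∀ (u : Λ) (σ : Fin 2),
        (numberOp u σ : Matrix (Finset (Orb Λ)) (Finset (Orb Λ)) ℂ)ᴴ = numberOp u σ :=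
      fun u σ => (numberAt_isHermitian (orb u σ)).eq
    unfold IsHermitian totalNumber
    simp only [conjTranspose_smul, conjTranspose_sum, hn, Complex.star_def, Complex.conj_ofReal]
  exact ((isHermitian_bdgHopping hτ).add (isHermitian_bdgPairing_add_conjTranspose Δ)).sub hN

variable (G : SimpleGraph Λ) [DecidableRel G.Adj]

/-- Graph-supported real bond weights give the tree's hopping operator:
`T([x ∼ y] w(x,y)) = hoppingForm G w`. [folklore] -/
theorem bdgHopping_adj (w : Λ → Λ → ℝ) :
    bdgHopping (fun x y => if G.Adj x y then ((w x y : ℝ) : ℂ) else 0) = hoppingForm G w := by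
  simp only [bdgHopping, hoppingForm, ite_smul, zero_smul]

/-- **The free Hubbard model is a BdG Hamiltonian**: with hopping `τ(x,y) = -t[x ∼ y]` on a finite
graph `G`, no pairing and chemical potential `μ`,
`bdgBondHamiltonian τ 0 μ = hamiltonianWith G t 0 μ = H(t, U = 0) - μN`. [folklore] -/
theorem bdgBondHamiltonian_adj_zero (t μ : ℝ) :
    bdgBondHamiltonian (fun x y => if G.Adj x y then -(t : ℂ) else 0) 0 μ = hamiltonianWith G t 0 μ := by
  simp only [bdgBondHamiltonian, bdgPairing_zero, conjTranspose_zero, add_zero, hamiltonianWith,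
    hamiltonian, Complex.ofReal_zero, zero_smul, bdgHopping]
  congr 1
  simp only [Finset.smul_sum, smul_ite, smul_zero, ite_smul, zero_smul]

/-! ### Gauge covariance -/

/-- **Gauge covariance of the hopping part** (Koma–Tasaki eq. (7) at real angles; the Peierls
substitution): `W_g T(τ) W_gᴴ = T(g_x conj(g_y) τ(x,y))` — for `g = e^{iθ}` the factor is
`e^{i(θ_x - θ_y)}`: the phase enters only through bond DIFFERENCES. [cite: KomaTasakiPRL1992, eq. (7)] -/
theorem phaseGauge_mul_bdgHopping_mul_conjTranspose (g : Λ → Circle) (τ : Λ → Λ → ℂ) :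
    phaseGauge g * bdgHopping τ * (phaseGauge g)ᴴ =
      bdgHopping fun x y => (g x : ℂ) * conj (g y : ℂ) * τ x y := by
  simp only [bdgHopping, Finset.mul_sum, Finset.sum_mul, Matrix.mul_smul, Matrix.smul_mul]
  refine Finset.sum_congr rfl fun x _ => Finset.sum_congr rfl fun y _ =>
    Finset.sum_congr rfl fun σ _ => ?_
  rw [phaseGauge_mul_mul_mul_conjTranspose, phaseGauge_mul_creation_mul_conjTranspose,
    phaseGauge_mul_annihilation_mul_conjTranspose, smul_mul_smul, smul_smul, mul_comm (τ x y)]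

/-- **Gauge covariance of the pairing part** (Vafek et al. (A2); Koma–Tasaki eq. (8)):
`W_g P(Δ) W_gᴴ = P(conj(g_x) conj(g_y) Δ(x,y))` (`e^{-i(θ_x + θ_y)}` for `g = e^{iθ}`).
[cite: VafekEtAl2001, App. A eq. (A2)] -/
theorem phaseGauge_mul_bdgPairing_mul_conjTranspose (g : Λ → Circle) (Δ : Λ → Λ → ℂ) :
    phaseGauge g * bdgPairing Δ * (phaseGauge g)ᴴ =
      bdgPairing fun x y => conj (g x : ℂ) * conj (g y : ℂ) * Δ x y := by
  simp only [bdgPairing, Finset.mul_sum, Finset.sum_mul, Matrix.mul_smul, Matrix.smul_mul]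
  refine Finset.sum_congr rfl fun x _ => Finset.sum_congr rfl fun y _ => ?_
  rw [Matrix.mul_sub, Matrix.sub_mul, phaseGauge_mul_mul_mul_conjTranspose,
    phaseGauge_mul_mul_mul_conjTranspose, phaseGauge_mul_annihilation_mul_conjTranspose,
    phaseGauge_mul_annihilation_mul_conjTranspose, phaseGauge_mul_annihilation_mul_conjTranspose,
    phaseGauge_mul_annihilation_mul_conjTranspose, smul_mul_smul, smul_mul_smul, ← smul_sub,
    smul_smul, mul_comm (Δ x y)]

/-- **`U(1)` gauge covariance of the BdG Hamiltonian** (de Gennes' "gauge covariance of the pair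
potential", §5-2; Vafek et al. (A2); Koma–Tasaki eqs. (7)–(8)): conjugating by the unitary
site-phase transformation `W_g`, `g : Λ → U(1)`, is the same as transforming the bond data,
`τ(x,y) ↦ g_x conj(g_y) τ(x,y)` (Peierls factor) and `Δ(x,y) ↦ conj(g_x) conj(g_y) Δ(x,y)`, the
chemical-potential term being invariant; in particular the spectrum depends on the bond data only
through gauge-equivalence classes. [cite: deGennes1966, §5-2 eqs. (5-33)–(5-38)] -/
theorem phaseGauge_mul_bdgBondHamiltonian_mul_conjTranspose (g : Λ → Circle) (τ Δ : Λ → Λ → ℂ)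
    (μ : ℝ) :
    phaseGauge g * bdgBondHamiltonian τ Δ μ * (phaseGauge g)ᴴ =
      bdgBondHamiltonian (fun x y => (g x : ℂ) * conj (g y : ℂ) * τ x y)
        (fun x y => conj (g x : ℂ) * conj (g y : ℂ) * Δ x y) μ := by
  simp only [bdgBondHamiltonian, Matrix.mul_add, Matrix.add_mul, Matrix.mul_sub, Matrix.sub_mul,
    Matrix.mul_smul, Matrix.smul_mul, phaseGauge_mul_conjTranspose_mul_conjTranspose,
    phaseGauge_mul_bdgHopping_mul_conjTranspose, phaseGauge_mul_bdgPairing_mul_conjTranspose,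
    phaseGauge_mul_totalNumber_mul_conjTranspose]

/-- The same at real angles `g = e^{iθ}` (the form of the request): `τ(x,y) ↦ e^{i(θ_x-θ_y)} τ(x,y)`,
`Δ(x,y) ↦ e^{-i(θ_x+θ_y)} Δ(x,y)`. [cite: VafekEtAl2001, App. A eq. (A2)] -/
theorem phaseGauge_exp_mul_bdgBondHamiltonian_mul_conjTranspose (θ : Λ → ℝ) (τ Δ : Λ → Λ → ℂ)
    (μ : ℝ) :
    phaseGauge (fun x => Circle.exp (θ x)) * bdgBondHamiltonian τ Δ μ *
        (phaseGauge fun x => Circle.exp (θ x))ᴴ =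
      bdgBondHamiltonian (fun x y => Complex.exp (Complex.I * (θ x - θ y)) * τ x y)
        (fun x y => Complex.exp (-(Complex.I * (θ x + θ y))) * Δ x y) μ := by
  rw [phaseGauge_mul_bdgBondHamiltonian_mul_conjTranspose]
  congr 1 <;> funext x y <;> congr 1
  · rw [Circle.coe_exp, Circle.coe_exp, ← Complex.exp_conj, map_mul, Complex.conj_ofReal,
      Complex.conj_I, ← Complex.exp_add]
    congr 1
    ring
  · rw [Circle.coe_exp, Circle.coe_exp, ← Complex.exp_conj, ← Complex.exp_conj, map_mul, map_mul,
      Complex.conj_ofReal, Complex.conj_ofReal, Complex.conj_I, ← Complex.exp_add]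
    congr 1
    ring

/-- **`ℤ₂` gauge covariance**: the sign change `g = -1` on a set of sites `S` (`+1` off `S`) flips
the sign of `τ(x,y)` and of `Δ(x,y)` exactly on the bonds with one end in `S` and the other
outside: `(τ, Δ)(x,y) ↦ ε_x ε_y (τ, Δ)(x,y)`. (This is how a `ℤ₂` flux string is moved at fixed
endpoints.) [cite: VafekEtAl2001, App. A eq. (A2)] -/
theorem phaseGauge_sign_mul_bdgBondHamiltonian_mul_conjTranspose (S : Finset Λ) (τ Δ : Λ → Λ → ℂ)
    (μ : ℝ) :
    phaseGauge (fun x => if x ∈ S then -1 else 1) * bdgBondHamiltonian τ Δ μ *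
        (phaseGauge fun x => if x ∈ S then -1 else 1)ᴴ =
      bdgBondHamiltonian
        (fun x y => (if x ∈ S then -1 else 1) * (if y ∈ S then -1 else 1) * τ x y)
        (fun x y => (if x ∈ S then -1 else 1) * (if y ∈ S then -1 else 1) * Δ x y) μ := by
  rw [phaseGauge_mul_bdgBondHamiltonian_mul_conjTranspose]
  congr 1 <;> funext x y <;> congr 1 <;> by_cases hx : x ∈ S <;> by_cases hy : y ∈ S <;>
    simp [hx, hy]

end BdG

end Literature.MathematicalPhysics.QuantumLattice
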